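import Mathlib.Analysis.InnerProductSpace.LaxMilgram
import Mathlib.Analysis.Analytic.Constructions
import Mathlib.Topology.Algebra.Module.Equiv
import HarnessLib

/-!
# Analytic dependence of a constrained energy minimum on the quadratic form (Lax–Milgram)

Topic `Literature/Probability/RandomPlanarGeometry`; abstract functional-analytic lemma used by the
variational proof of `ShearCrossRatioAnalytic` (`ShearModulusAnalytic.lean`: the conformal modulus
of a sheared quadrilateral is real-analytic in the shear). Everything here is PROVED; no
definition of a named fact is introduced.

Setting: `H` a real Hilbert space, `B : H →L[ℝ] H →L[ℝ] ℝ` a bounded bilinear form which is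
symmetric and coercive (`IsCoercive`), `r : H`, `r ≠ 0`. The constrained minimum
`inf {B g g | ⟪r, g⟫ = 1}` (a "modulus" / capacity) equals `1 / ⟪r, A⁻¹ r⟫` where `A = B♯` is the
Lax–Milgram operator (`IsCoercive.continuousLinearEquivOfBilin`): the lower bound is the
Cauchy–Schwarz inequality for `B` (`bilin_sq_le`, `energyValue_le`), and the value is approached
on any dense submodule (`exists_mem_lt_energyValue_add`). Since `B ↦ B♯` is continuous linear and
`Ring.inverse` is analytic at units (`analyticAt_inverse`), the value `1 / ⟪r, (B♯)⁻¹ r⟫` is a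
real-analytic function of `B` along any analytic family of coercive symmetric forms
(`analyticAt_energyValue`). This is the classical argument for the analytic dependence of
Dirichlet-type extremal problems on analytically varying coefficients (Lax–Milgram 1954; Kato,
*Perturbation Theory for Linear Operators* (1966), Ch. VII §4, holomorphic families of forms).

## Mathlib

USED: `IsCoercive.continuousLinearEquivOfBilin(_apply)`, `continuousLinearMapOfBilin(_apply)`,
`analyticAt_inverse`, `ContinuousLinearEquiv.toUnit`, `Dense.exists_mem_open`.

## References

* P. D. Lax, A. N. Milgram, *Parabolic equations*, Ann. of Math. Stud. 33 (1954), 167–190.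
* T. Kato, *Perturbation Theory for Linear Operators*, Springer (1966), Ch. VII §4. [folklore]
-/

noncomputable section

open Filter Topology InnerProductSpace Set
open scoped RealInnerProductSpace

namespace Literature.Probability.RandomPlanarGeometry

namespace ModulusEnergy

variable {H : Type*} [NormedAddCommGroup H] [InnerProductSpace ℝ H]

/-- **Cauchy–Schwarz for a nonnegative symmetric bounded bilinear form**:
`(B u v)² ≤ B u u · B v v`. [folklore] -/
theorem bilin_sq_le (B : H →L[ℝ] H →L[ℝ] ℝ) (hsymm : ∀ u v, B u v = B v u)
    (hpos : ∀ u, 0 ≤ B u u) (u v : H) : (B u v) ^ 2 ≤ B u u * B v v := by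
  have key : ∀ t : ℝ, 0 ≤ B u u - 2 * t * B u v + t ^ 2 * B v v := by
    intro t
    have h := hpos (u - t • v)
    have hexp : B (u - t • v) (u - t • v) = B u u - 2 * t * B u v + t ^ 2 * B v v := by
      simp only [map_sub, map_smul, FunLike.coe_sub, FunLike.coe_smul,
        Pi.sub_apply, Pi.smul_apply, smul_eq_mul, hsymm v u]
      ring
    rwa [hexp] at h
  rcases (hpos v).lt_or_eq with hv | hv
  · have h := key (B u v / B v v)
    have h' : 0 ≤ (B u u - 2 * (B u v / B v v) * B u v + (B u v / B v v) ^ 2 * B v v) * B v v :=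
      mul_nonneg h hv.le
    have hcalc : (B u u - 2 * (B u v / B v v) * B u v + (B u v / B v v) ^ 2 * B v v) * B v v =
        B u u * B v v - (B u v) ^ 2 := by
      field_simp
      ring
    linarith [hcalc ▸ h']
  · -- `B v v = 0`: then `B u v = 0`
    rw [← hv, mul_zero]
    have h0 : B u v = 0 := by
      by_contra hne
      have h := key ((B u u + 1) / (2 * B u v))
      rw [← hv, mul_zero, add_zero] at h
      have : 2 * ((B u u + 1) / (2 * B u v)) * B u v = B u u + 1 := by
        field_simp
      linarith
    rw [h0]
    norm_num

variable [CompleteSpace H] {B : H →L[ℝ] H →L[ℝ] ℝ}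

/-- The Lax–Milgram operator `B♯` of a coercive form is a unit of `H →L[ℝ] H`. [folklore] -/
theorem isUnit_continuousLinearMapOfBilin (hB : IsCoercive B) :
    IsUnit (continuousLinearMapOfBilin (𝕜 := ℝ) B) := by
  have h : (hB.continuousLinearEquivOfBilin : H →L[ℝ] H) = continuousLinearMapOfBilin (𝕜 := ℝ) B :=
    rfl
  rw [← h]
  exact ⟨hB.continuousLinearEquivOfBilin.toUnit, rfl⟩

/-- `Ring.inverse B♯` is the inverse Lax–Milgram equivalence. [folklore] -/
theorem inverse_continuousLinearMapOfBilin (hB : IsCoercive B) :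
    Ring.inverse (continuousLinearMapOfBilin (𝕜 := ℝ) B) =
      (hB.continuousLinearEquivOfBilin.symm : H →L[ℝ] H) := by
  have h : (hB.continuousLinearEquivOfBilin : H →L[ℝ] H) = continuousLinearMapOfBilin (𝕜 := ℝ) B :=
    rfl
  rw [← h]
  change Ring.inverse ((hB.continuousLinearEquivOfBilin.toUnit : (H →L[ℝ] H)ˣ) : H →L[ℝ] H) = _
  rw [Ring.inverse_unit]
  rfl

/-- The minimiser `w = (B♯)⁻¹ r` represents the constraint functional through `B`:
`B w g = ⟪r, g⟫`. [folklore] -/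
theorem bilin_inverse_apply (hB : IsCoercive B) (r g : H) :
    B (Ring.inverse (continuousLinearMapOfBilin (𝕜 := ℝ) B) r) g = ⟪r, g⟫ := by
  rw [inverse_continuousLinearMapOfBilin hB, ← hB.continuousLinearEquivOfBilin_apply]
  change ⟪hB.continuousLinearEquivOfBilin (hB.continuousLinearEquivOfBilin.symm r), g⟫ = ⟪r, g⟫
  rw [ContinuousLinearEquiv.apply_symm_apply]

/-- `⟪r, (B♯)⁻¹ r⟫ = B w w` for `w = (B♯)⁻¹ r` (symmetric `B`). [folklore] -/
theorem inner_inverse_eq (hB : IsCoercive B) (r : H) :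
    ⟪r, Ring.inverse (continuousLinearMapOfBilin (𝕜 := ℝ) B) r⟫ =
      B (Ring.inverse (continuousLinearMapOfBilin (𝕜 := ℝ) B) r)
        (Ring.inverse (continuousLinearMapOfBilin (𝕜 := ℝ) B) r) := by
  rw [bilin_inverse_apply hB]

/-- For `r ≠ 0`, `⟪r, (B♯)⁻¹ r⟫ > 0`. [folklore] -/
theorem inner_inverse_pos (hB : IsCoercive B) {r : H} (hr : r ≠ 0) : 0 < ⟪r, Ring.inverse (continuousLinearMapOfBilin (𝕜 := ℝ) B) r⟫ := by
  rw [inner_inverse_eq hB]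
  set w := Ring.inverse (continuousLinearMapOfBilin (𝕜 := ℝ) B) r with hw
  obtain ⟨C, hC, hcoer⟩ := hB
  have hw0 : w ≠ 0 := by
    intro h0
    have h := bilin_inverse_apply ⟨C, hC, hcoer⟩ r r
    rw [← hw, h0, map_zero, FunLike.coe_zero, Pi.zero_apply] at h
    exact hr (inner_self_eq_zero.1 h.symm)
  have h1 : 0 < C * ‖w‖ * ‖w‖ := by
    have := norm_pos_iff.2 hw0
    positivity
  exact h1.trans_le (hcoer w)

/-- The energy value `1 / ⟪r, (B♯)⁻¹ r⟫` is positive (`r ≠ 0`). [folklore] -/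
theorem energyValue_pos (hB : IsCoercive B) {r : H} (hr : r ≠ 0) :
    0 < 1 / ⟪r, Ring.inverse (continuousLinearMapOfBilin (𝕜 := ℝ) B) r⟫ :=
  one_div_pos.2 (inner_inverse_pos hB hr)

/-- **Lower bound** (Cauchy–Schwarz): every competitor `g` with `⟪r, g⟫ = 1` has
`B g g ≥ 1 / ⟪r, (B♯)⁻¹ r⟫`. [folklore] -/
theorem energyValue_le (hB : IsCoercive B) (hsymm : ∀ u v, B u v = B v u) {r g : H} (hr : r ≠ 0)
    (hg : ⟪r, g⟫ = 1) : 1 / ⟪r, Ring.inverse (continuousLinearMapOfBilin (𝕜 := ℝ) B) r⟫ ≤ B g g := by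
  set w := Ring.inverse (continuousLinearMapOfBilin (𝕜 := ℝ) B) r with hw
  have hpos : ∀ u, 0 ≤ B u u := by
    obtain ⟨C, hC, hcoer⟩ := hB
    intro u
    exact le_trans (by positivity) (hcoer u)
  have h1 : B w g = 1 := by rw [hw, bilin_inverse_apply hB, hg]
  have hcs := bilin_sq_le B hsymm hpos w g
  rw [h1, one_pow] at hcs
  have hww : 0 < B w w := by
    have := inner_inverse_pos hB hr
    rwa [inner_inverse_eq hB] at this
  rw [inner_inverse_eq hB, ← hw, div_le_iff₀ hww]
  linarith [mul_comm (B w w) (B g g)]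

/-- **The value is attained in the limit on any dense submodule**: for every `ε > 0` there is a
competitor `g` in the dense submodule `F` with `⟪r, g⟫ = 1` and `B g g < 1/⟪r, (B♯)⁻¹ r⟫ + ε`
(rescale approximants of the minimiser `w / ⟪r, w⟫`). [folklore] -/
theorem exists_mem_lt_energyValue_add (hB : IsCoercive B) {r : H} (hr : r ≠ 0)
    {F : Submodule ℝ H} (hF : Dense (F : Set H)) {ε : ℝ} (hε : 0 < ε) :
    ∃ g ∈ F, ⟪r, g⟫ = 1 ∧
      B g g < 1 / ⟪r, Ring.inverse (continuousLinearMapOfBilin (𝕜 := ℝ) B) r⟫ + ε := by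
  set w := Ring.inverse (continuousLinearMapOfBilin (𝕜 := ℝ) B) r with hw
  have hrw : 0 < ⟪r, w⟫ := inner_inverse_pos hB hr
  -- the rescaled competitor functional `g ↦ B (⟪r,g⟫⁻¹ • g) (⟪r,g⟫⁻¹ • g)` is continuous at `w`
  set Φ : H → ℝ := fun g => B ((⟪r, g⟫)⁻¹ • g) ((⟪r, g⟫)⁻¹ • g) with hΦ
  have hcont : ContinuousAt Φ w := by
    have h1 : ContinuousAt (fun g : H => (⟪r, g⟫)⁻¹) w :=
      ((continuous_const.inner continuous_id).continuousAt).inv₀ hrw.ne'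
    have h2 : ContinuousAt (fun g : H => (⟪r, g⟫)⁻¹ • g) w := h1.smul continuousAt_id
    have hB2 : Continuous fun p : H × H => B p.1 p.2 := B.continuous₂
    exact (hB2.continuousAt.comp (h2.prodMk h2) : _)
  have hΦw : Φ w = 1 / ⟪r, w⟫ := by
    simp only [hΦ, map_smul, FunLike.coe_smul, Pi.smul_apply, smul_eq_mul]
    have hww : B w w = ⟪r, w⟫ := by rw [hw, ← inner_inverse_eq hB]
    rw [hww]
    field_simp
  -- a neighbourhood of `w` on which `Φ < value + ε` and `⟪r, ·⟫ > 0`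
  have hev : ∀ᶠ g in 𝓝 w, Φ g < 1 / ⟪r, w⟫ + ε ∧ 0 < ⟪r, g⟫ := by
    refine (hcont.eventually (gt_mem_nhds (by linarith : Φ w < 1 / ⟪r, w⟫ + ε))).and ?_
    exact ((continuous_const.inner continuous_id).continuousAt).eventually (lt_mem_nhds hrw)
  obtain ⟨U, hU, hUopen, hwU⟩ := eventually_nhds_iff.1 hev
  obtain ⟨g, hgF, hgU⟩ := hF.exists_mem_open hUopen ⟨w, hwU⟩
  obtain ⟨hg1, hg2⟩ := hU g hgU
  refine ⟨(⟪r, g⟫)⁻¹ • g, F.smul_mem _ hgF, ?_, hg1⟩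
  rw [inner_smul_right, inv_mul_cancel₀ hg2.ne']

/-! ### Analytic dependence on the form -/

variable {E : Type*} [NormedAddCommGroup E] [NormedSpace ℝ E]

/-- `B ↦ B♯` is (the restriction of) a continuous linear map, hence analytic along analytic
families. [folklore] -/
theorem analyticAt_continuousLinearMapOfBilin {Bf : E → (H →L[ℝ] H →L[ℝ] ℝ)} {t₀ : E}
    (hBf : AnalyticAt ℝ Bf t₀) :
    AnalyticAt ℝ (fun t => continuousLinearMapOfBilin (𝕜 := ℝ) (Bf t)) t₀ := by
  set L : (H →L[ℝ] ℝ) →L[ℝ] H :=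
    ((InnerProductSpace.toDual ℝ H).symm.toContinuousLinearEquiv : (H →L[ℝ] ℝ) →L[ℝ] H) with hL
  have h : (fun t => continuousLinearMapOfBilin (𝕜 := ℝ) (Bf t)) =
      fun t => (ContinuousLinearMap.compL ℝ H (H →L[ℝ] ℝ) H L) (Bf t) := by
    funext t
    rfl
  rw [h]
  exact ((ContinuousLinearMap.compL ℝ H (H →L[ℝ] ℝ) H L).analyticAt _).comp hBf

/-- `t ↦ (Bf t ♯)⁻¹` is analytic at `t₀` when `Bf` is analytic there and `Bf t₀` is coercive.
[folklore] -/
theorem analyticAt_inverse_continuousLinearMapOfBilin {Bf : E → (H →L[ℝ] H →L[ℝ] ℝ)} {t₀ : E}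
    (hBf : AnalyticAt ℝ Bf t₀) (hB : IsCoercive (Bf t₀)) :
    AnalyticAt ℝ (fun t => Ring.inverse (continuousLinearMapOfBilin (𝕜 := ℝ) (Bf t))) t₀ := by
  obtain ⟨u, hu⟩ := isUnit_continuousLinearMapOfBilin hB
  have h1 : AnalyticAt ℝ Ring.inverse (continuousLinearMapOfBilin (𝕜 := ℝ) (Bf t₀)) := by
    rw [← hu]
    exact analyticAt_inverse u
  have h2 := analyticAt_continuousLinearMapOfBilin (Bf := Bf) (t₀ := t₀) hBf
  change AnalyticAt ℝ (Ring.inverse ∘ fun t => continuousLinearMapOfBilin (𝕜 := ℝ) (Bf t)) t₀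
  exact AnalyticAt.comp h1 h2

/-- **Analytic dependence of the energy value on the form.** If `t ↦ Bf t` is an analytic family
of bounded bilinear forms on a real Hilbert space and `Bf t₀` is coercive and symmetric, then
the energy value `t ↦ 1/⟪r, (Bf t ♯)⁻¹ r⟫` is real-analytic at `t₀` (`r ≠ 0`). [folklore] -/
theorem analyticAt_energyValue {Bf : E → (H →L[ℝ] H →L[ℝ] ℝ)} {t₀ : E}
    (hBf : AnalyticAt ℝ Bf t₀) (hB : IsCoercive (Bf t₀)) {r : H} (hr : r ≠ 0) :
    AnalyticAt ℝ
      (fun t => 1 / ⟪r, Ring.inverse (continuousLinearMapOfBilin (𝕜 := ℝ) (Bf t)) r⟫) t₀ := by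
  have h1 := analyticAt_inverse_continuousLinearMapOfBilin hBf hB
  have h2 : AnalyticAt ℝ
      (fun t => Ring.inverse (continuousLinearMapOfBilin (𝕜 := ℝ) (Bf t)) r) t₀ :=
    ((ContinuousLinearMap.apply ℝ H r).analyticAt _).comp h1
  have h3 : AnalyticAt ℝ
      (fun t => ⟪r, Ring.inverse (continuousLinearMapOfBilin (𝕜 := ℝ) (Bf t)) r⟫) t₀ :=
    ((innerSL ℝ r).analyticAt _).comp h2
  exact analyticAt_const.div h3 (inner_inverse_pos hB hr).ne'

end ModulusEnergy

end Literature.Probability.RandomPlanarGeometry
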